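import Summits.AtomisticToContinuum.HydrodynamicLimit.Theorems.JParityClosureRateFloorPerParticleFreeStretch
import Summits.AtomisticToContinuum.HydrodynamicLimit.Theorems.JParityClosureRateFloorWouldBeRealised
import HarnessLib

/-!
# A realised would-be pair enters the collision functional with the predicted datum
# (`stub_realisedDatum`, registered stub S6a of the line `Sketch` of the crux
# `JParityClosure.RateFloor`, stmt-AtomisticToContinuum-13080)

The crux's collision functional `Kc` evaluates, at each collision time `t` and ordered contact
pair `(i, j)`, a mark at the datum `(ε⁻¹ • n, pv.1, pv.2)` with `n = sepVec xᵢ(t) xⱼ(t)` the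
CURRENT separation vector and `pv := reflectVel n (vᵢ(t), vⱼ(t))` the CURRENT (post-collisional,
trajectories are right-continuous) velocities reflected across it.  This file pins that a
would-be pair realised at the end `t` of a window `(s, t)` during which neither `i` nor `j`
collides enters `Kc` with exactly the FREE-FLIGHT-PREDICTED datum issued from `γ s`:
* the separation vector at `t` is the free-flight separation vector (positions do not jump:
  S1 `RateFloorPerParticleFreeStretch.stub_perParticleFreeStretch` puts `i` and `j` on their
  free flights on `[s, t)`, and `RateFloorWouldBeRealised.apply_fst_eq_freeFlight_of_forall_Ico`
  passes to `t` by continuity of positions);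
* `pv = (vᵢ(s), vⱼ(s))`: the pair is then in contact at `t`, so by the `binary` field of
  `IsHardSphereTrajectory` (`IsHardSphereTrajectory.eq_collidePair_leftLim`)
  `γ t = collidePair i j zl` with `zl` the left limit of `γ` at `t`; positions are unchanged by
  `collidePair` and `reflectVel n` is an involution (`reflectVel_reflectVel`), so
  `pv = ((zl i).2, (zl j).2)` (this is Disproof §1 `pv_eq_precollisional`); finally the
  velocities of `i` and `j` are constant `= vᵢ(s), vⱼ(s)` on `(s, t)` (free flight), hence so
  are those of the left limit (`tendsto_nhds_unique` along `𝓝[<] t`).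

No regularity of the geometry beyond the continuity of translations on `𝕋³` is used (the
hypotheses `0 < ε < 1/2` of the registered signature are not needed).

References: Gallagher–Saint-Raymond–Texier 2013 §4.1 (hard-sphere trajectories); elementary.
-/

noncomputable section

namespace Summit.AtomisticToContinuum.HydrodynamicLimit.Theorems

open MeasureTheory Set Filter Topology
open Literature.Analysis.FluidPDE Literature.MathematicalPhysics.KineticTheory

namespace RateFloorRealisedDatum

variable {d : Type*} [Fintype d] {X : Type*} {N : ℕ}

/-- **`pv` is the pre-collisional pair.**  Reflecting the post-collisional velocities of the
colliding pair `(i, j)` across the (unchanged) separation vector returns the pre-collisional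
velocities: `collidePair` does not move the particles and `reflectVel n` is an involution
(Disproof §1 `pv_eq_precollisional`). [folklore] -/
theorem reflectVel_collidePair (G : Geometry d X) {i j : Fin N} (hij : i ≠ j)
    (zl : Config N d X) :
    reflectVel (G.sepVec (collidePair G i j zl i).1 (collidePair G i j zl j).1)
        ((collidePair G i j zl i).2, (collidePair G i j zl j).2) = ((zl i).2, (zl j).2) := by
  -- adapted from Cruxes/RateFloor/Disproof.lean `pv_eq_precollisional`
  rw [collidePair_apply_fst, collidePair_apply_fst, collidePair_apply_left hij,
    collidePair_apply_right]
  exact reflectVel_reflectVel _ _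

/-- **Velocities of the left limit on a free stretch.**  If particle `k` of a hard-sphere
trajectory on `𝕋³` is on its free flight issued from `γ s` at every time of `[s, t)` (`s < t`),
then the velocity of `k` in the left limit of `γ` at `t` is `vₖ(s)` (the velocity is constant
on `(s, t)`, a set of the filter `𝓝[<] t`, and the left limit exists,
`IsHardSphereTrajectory.tendsto_leftLim`). [folklore] -/
theorem leftLim_apply_snd_eq {ε : ℝ} {γ : ℝ → Config N (Fin 3) T3}
    (h : IsHardSphereTrajectory (Torus.geometry (Fin 3)) ε N γ) {s t : ℝ} (hst : s < t)
    {k : Fin N}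
    (heq : ∀ u ∈ Ico s t, γ u k = freeFlight (Torus.geometry (Fin 3)) (u - s) (γ s) k) :
    (Function.leftLim γ t k).2 = (γ s k).2 := by
  have hev : Continuous fun z : Config N (Fin 3) T3 => (z k).2 := by fun_prop
  have h1 : Tendsto (fun u => (γ u k).2) (𝓝[<] t) (𝓝 (Function.leftLim γ t k).2) :=
    (hev.tendsto _).comp (h.tendsto_leftLim Torus.continuous_geometry_translate t)
  have h2 : Tendsto (fun u => (γ u k).2) (𝓝[<] t) (𝓝 (γ s k).2) := by
    refine tendsto_const_nhds.congr' ?_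
    filter_upwards [Ioo_mem_nhdsLT hst] with u hu
    rw [heq u ⟨hu.1.le, hu.2⟩, freeFlight_apply]
  exact tendsto_nhds_unique h1 h2

/-- **S6a · realised datum** (registered stub `stub_realisedDatum` of the line `Sketch`, crux
`JParityClosure.RateFloor`, stmt-AtomisticToContinuum-13080).  On a hard-sphere trajectory on
`𝕋³`: if neither `i` nor `j ≠ i` takes part in a collision during `(s, t)` (`s < t`) and their
free flights issued from `γ s` are at minimal-image distance exactly `ε` at time `t`, then at
time `t` the separation vector of `(i, j)` is the free-flight one and the current velocities
reflected across it are the window-start velocities `(vᵢ(s), vⱼ(s))`: the realised would-be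
pair enters the collision functional with the free-flight-predicted datum.  Proof in the module
docstring. [folklore] -/
theorem stub_realisedDatum :
    ∀ (N : ℕ) (ε : ℝ) (γ : ℝ → Config N (Fin 3) T3),
    IsHardSphereTrajectory (Torus.geometry (Fin 3)) ε N γ → 0 < ε → ε < 2⁻¹ →
    ∀ (s t : ℝ) (i j : Fin N), s < t → i ≠ j →
      (∀ u ∈ Set.Ioo s t, u ∉ collisionTimesOf (Torus.geometry (Fin 3)) ε γ i) →
      (∀ u ∈ Set.Ioo s t, u ∉ collisionTimesOf (Torus.geometry (Fin 3)) ε γ j) →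
      ‖(Torus.geometry (Fin 3)).sepVec (freeFlight (Torus.geometry (Fin 3)) (t - s) (γ s) i).1
          (freeFlight (Torus.geometry (Fin 3)) (t - s) (γ s) j).1‖ = ε →
      (Torus.geometry (Fin 3)).sepVec (γ t i).1 (γ t j).1 =
          (Torus.geometry (Fin 3)).sepVec (freeFlight (Torus.geometry (Fin 3)) (t - s) (γ s) i).1
            (freeFlight (Torus.geometry (Fin 3)) (t - s) (γ s) j).1 ∧
        reflectVel ((Torus.geometry (Fin 3)).sepVec (γ t i).1 (γ t j).1) ((γ t i).2, (γ t j).2) =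
          ((γ s i).2, (γ s j).2) := by
  intro N ε γ h _hε _hε2 s t i j hst hij hi hj hcontact
  -- S1 on the sub-windows `(s, u] ⊆ (s, t)`, `u ∈ [s, t)`: `i` and `j` are on their free flights
  have hfree : ∀ k : Fin N,
      (∀ u ∈ Set.Ioo s t, u ∉ collisionTimesOf (Torus.geometry (Fin 3)) ε γ k) →
      ∀ u ∈ Ico s t, γ u k = freeFlight (Torus.geometry (Fin 3)) (u - s) (γ s) k :=
    fun k hk u hu =>
      RateFloorPerParticleFreeStretch.stub_perParticleFreeStretch N ε γ h s u k hu.1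
        fun w hw => hk w ⟨hw.1, hw.2.trans_lt hu.2⟩
  -- positions at time `t` are the free-flight positions (continuity of positions)
  have hi' := RateFloorWouldBeRealised.apply_fst_eq_freeFlight_of_forall_Ico
    (h.pos_continuous i) hst (hfree i hi)
  have hj' := RateFloorWouldBeRealised.apply_fst_eq_freeFlight_of_forall_Ico
    (h.pos_continuous j) hst (hfree j hj)
  have hsep : (Torus.geometry (Fin 3)).sepVec (γ t i).1 (γ t j).1 =
      (Torus.geometry (Fin 3)).sepVec (freeFlight (Torus.geometry (Fin 3)) (t - s) (γ s) i).1
        (freeFlight (Torus.geometry (Fin 3)) (t - s) (γ s) j).1 := by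
    rw [hi', hj']
  refine ⟨hsep, ?_⟩
  -- the pair is in contact at `t`: `γ t` is the elastic reflection of the left limit
  have hct : γ t ∈ contactSet (Torus.geometry (Fin 3)) N ε i j :=
    mem_contactSet.2 ⟨h.mem t, by rw [hsep]; exact hcontact⟩
  obtain ⟨-, hγt⟩ := h.eq_collidePair_leftLim hij hct
  rw [hγt, reflectVel_collidePair _ hij, leftLim_apply_snd_eq h hst (hfree i hi),
    leftLim_apply_snd_eq h hst (hfree j hj)]

end RateFloorRealisedDatum

end Summit.AtomisticToContinuum.HydrodynamicLimit.Theorems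

end
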